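import Mathlib
import HarnessLib
import Summits.CriticalPhenomena.PercolationContinuityZ3.Theorems.PercNearOneGluingNoHeavyLowerTailTwoCopyLadderAllGradesRailApexU

/-!
# The RAIL theorem on the extended orbit `𝒦⁺ × 𝒦⁺`, part 2: the apex–`w` edge and the theorem (sequel to `…AllGradesRailApexU`)

Helper file for crux `stmt-CriticalPhenomena-4575` (new-inequality factory `prim-ineq-gen-1`, gen 22); memo
`run/shared/lean/prim/prim-ineq-gen-1/FINDING-31-prism-programme-4terminal.md` §6.  `…AllGradesRail` proved that the all-grade rail form
`Frail q X Y` (`= P_{G; av, zu}/q³` for `G ∖ av ∖ zu = X ∪_w Y`, the two sides sharing the terminal `w`, `f = zu` joining their `u`-terminals) lies in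
every positive cone along the LADDER orbit `Orb` (moves: terminal rung, q-pendants at `u`, `w`, merge).  Here the three APEX moves of
`…AllGradesApex` are added — the q-pendant at the apex `qpendX` (an exact multiple, `Frail_qpendX`) and the apex–terminal edges `edgeXU`, `edgeXW`
(old form plus `ρ`, `ρ²` times nonnegative combinations of `Aq`, mirror-`Aq`, `Dl`, mirror-`Dl` of either side and a polynomial with nonnegative
coefficients: `Frail_edgeXU`, `Frail_edgeXW`; multipliers found by the bi-form tower kit j169926 — one generator, sixteen certificates, all integer —
and checked here by `ring`) — so `Frail q X Y ∈ P` for ALL `X, Y` in the extended orbit `OrbX` (`Frail_pos_of_orbX`): for every `q ≥ 0` and in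
every glueing `G = X ∪_w Y + zu + av` of two `𝒦⁺`-sides (strips with apex history: fans, wheels with a marked rim edge, triangulated bands, ladders
with diagonals) the apex edge `av` and the edge `zu` joining the two `u`-terminals are Rayleigh-negatively correlated at every `0 < q < 1`, with
nonnegative q-coefficients (`railX_allq_nonneg`, `railX_coeff_nonneg`).  This is also 'Step A' of the 4-terminal (prism) programme: the `ρ⁰`-parts of
the cyclic-ladder forms are rail forms at `𝒦⁺`-sides.  (This work, 2026-08-22.)
-/

namespace Summit.CriticalPhenomena.PercolationContinuityZ3.Theorems

namespace TwoCopyLadderAllGrades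

open TwoCopyLadderCubic

variable {R : Type*} [CommRing R]
/-- Part `a` of the `ρ` remainder of `Frail` under the apex–`w` edge on the first side (nonnegative combination of the side forms `Aq`, mirror-`Aq`, `Dl`, mirror-`Dl` and a polynomial with nonnegative integer coefficients; from the certificate kit j169926). [this work] -/
def FedgeW1a (q : R) (X Y : SVec R) : R :=
  q * (Aq q X) * (Aq q Y)
    + q ^ 2 * Y.m * Y.d * (Aq q X)
    + q * Y.c * Y.d * (Aq q X)
    + q * Y.c * Y.m * (Aq q X)
    + Y.c ^ 2 * (Aq q X)
    + q ^ 2 * X.d * X.s * (Aq q Y)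
    + q * X.d ^ 2 * (Aq q Y)
    + q ^ 2 * X.m * X.d * (Aq q Y)
    + q * X.p * X.d * (Aq q Y)
    + 2 * q * X.c * X.s * (Aq q Y)
    + (2 + q) * X.c * X.d * (Aq q Y)
    + 2 * q * X.c * X.m * (Aq q Y)
    + 2 * X.c * X.p * (Aq q Y)
    + 2 * X.c ^ 2 * (Aq q Y)
    + q ^ 2 * X.p * X.s * (Dl Y)
    + q * X.p * X.d * (Dl Y)
    + q ^ 2 * X.p * X.m * (Dl Y)
    + q * X.p ^ 2 * (Dl Y)
    + q * X.c * X.p * (Dl Y)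
    + 2 * X.p * X.d * Y.c * Y.p
    + 2 * X.p ^ 2 * Y.c * Y.p
    + 2 * X.c * X.p * Y.c * Y.p
    + 2 * q * X.p * X.s * Y.c * Y.p
    + q * X.p * X.d * Y.p * Y.d
    + q * X.p * X.d * Y.p * Y.m
    + q * X.p * X.d * Y.p ^ 2
    + 2 * q * X.p * X.m * Y.c * Y.p
    + q * X.p ^ 2 * Y.p * Y.d
    + q * X.p ^ 2 * Y.p * Y.m
    + q * X.p ^ 2 * Y.p ^ 2
    + q * X.c * X.p * Y.p * Y.d
    + q * X.c * X.p * Y.p * Y.m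
    + q * X.c * X.p * Y.p ^ 2
    + q ^ 2 * X.p * X.s * Y.p * Y.d
    + q ^ 2 * X.p * X.s * Y.p * Y.m
    + q ^ 2 * X.p * X.s * Y.p ^ 2

/-- Part `b` of the `ρ` remainder of `Frail` under the apex–`w` edge on the first side (nonnegative combination of the side forms `Aq`, mirror-`Aq`, `Dl`, mirror-`Dl` and a polynomial with nonnegative integer coefficients; from the certificate kit j169926). [this work] -/
def FedgeW1b (q : R) (X Y : SVec R) : R :=
  q ^ 2 * X.p * X.d * Y.p * Y.s
    + q ^ 2 * X.p * X.m * Y.p * Y.d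
    + q ^ 2 * X.p * X.m * Y.p * Y.m
    + q ^ 2 * X.p * X.m * Y.p ^ 2
    + q ^ 2 * X.p ^ 2 * Y.p * Y.s
    + q ^ 2 * X.c * X.p * Y.p * Y.s
    + q ^ 3 * X.p * X.s * Y.p * Y.s
    + q ^ 3 * X.p * X.m * Y.p * Y.s

/-- Part `a` of the `ρ²` remainder of `Frail` under the apex–`w` edge on the first side (nonnegative combination of the side forms `Aq`, mirror-`Aq`, `Dl`, mirror-`Dl` and a polynomial with nonnegative integer coefficients; from the certificate kit j169926). [this work] -/
def FedgeW2a (q : R) (X Y : SVec R) : R :=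
  q * X.d * X.s * (Aq q Y)
    + X.d ^ 2 * (Aq q Y)
    + q * X.m * X.d * (Aq q Y)
    + q * X.p * X.s * (Aq q Y)
    + (2 + q) * X.p * X.d * (Aq q Y)
    + q * X.p * X.m * (Aq q Y)
    + X.p ^ 2 * (Aq q Y)
    + 2 * X.c * X.d * (Aq q Y)
    + q * X.c * X.m * (Aq q Y)
    + 2 * X.c * X.p * (Aq q Y)
    + X.c ^ 2 * (Aq q Y)
    + q * (Dl (mir X)) * (Aq q Y)

/-- The rail form under the apex–`w` edge of weight `ρ` on the first side: old form plus `ρ`, `ρ²` times the nonnegative remainders above. [this work] -/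
theorem Frail_edgeXW (q ρ : R) (X Y : SVec R) :
    Frail q (edgeXW ρ X) Y = Frail q X Y + ρ * (FedgeW1a q X Y + FedgeW1b q X Y) + ρ ^ 2 * (FedgeW2a q X Y) := by
  simp only [Frail, Aq, Bq, C0q, Dl, mir, edgeXW, FedgeW1a, FedgeW1b, FedgeW2a]; ring

/-- `FedgeW1a` lies in the cone when the entries and side forms of both sides do. [this work] -/
theorem FedgeW1a_pos {P : R → Prop} (hP : IsPosCone P) {q : R} (hq : P q) {X Y : SVec R} (hX : GoodX P q X) (hY : GoodX P q Y) :
    P (FedgeW1a q X Y) := by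
  obtain ⟨hc, hp, hm, hd, hs, hA, hAm, hD, hDm⟩ := hX
  obtain ⟨hC, hPp, hM, hDd, hS, hAY, hAmY, hDY, hDmY⟩ := hY
  unfold FedgeW1a
  apply_rules (maxDepth := 5000) [hP.add, hP.mul, hP.pow, hP.zero, hP.one, hP.ofNat]

/-- `FedgeW1b` lies in the cone when the entries and side forms of both sides do. [this work] -/
theorem FedgeW1b_pos {P : R → Prop} (hP : IsPosCone P) {q : R} (hq : P q) {X Y : SVec R} (hX : GoodX P q X) (hY : GoodX P q Y) :
    P (FedgeW1b q X Y) := by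
  obtain ⟨hc, hp, hm, hd, hs, hA, hAm, hD, hDm⟩ := hX
  obtain ⟨hC, hPp, hM, hDd, hS, hAY, hAmY, hDY, hDmY⟩ := hY
  unfold FedgeW1b
  apply_rules (maxDepth := 5000) [hP.add, hP.mul, hP.pow, hP.zero, hP.one, hP.ofNat]

/-- `FedgeW2a` lies in the cone when the entries and side forms of both sides do. [this work] -/
theorem FedgeW2a_pos {P : R → Prop} (hP : IsPosCone P) {q : R} (hq : P q) {X Y : SVec R} (hX : GoodX P q X) (hY : GoodX P q Y) :
    P (FedgeW2a q X Y) := by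
  obtain ⟨hc, hp, hm, hd, hs, hA, hAm, hD, hDm⟩ := hX
  obtain ⟨hC, hPp, hM, hDd, hS, hAY, hAmY, hDY, hDmY⟩ := hY
  unfold FedgeW2a
  apply_rules (maxDepth := 5000) [hP.add, hP.mul, hP.pow, hP.zero, hP.one, hP.ofNat]

section Cone

variable {P : R → Prop}

set_option maxHeartbeats 400000 in
/-- THE RAIL THEOREM ON `𝒦⁺ × 𝒦⁺` (algebraic form): the rail form lies in the cone for every pair of sides of the EXTENDED orbit. [this work] -/
theorem Frail_pos_of_orbX (hP : IsPosCone P) {q : R} (hq : P q) {X Y : SVec R} (hX : OrbX P q X) (hY : OrbX P q Y) :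
    P (Frail q X Y) := by
  have gY := goodX_of_orbX hP hq hY
  obtain ⟨hC, hPp, hM, hDd, hS, hAY, hAmY, hDY, hDmY⟩ := id gY
  induction hX with
  | triv => rw [Frail_triv]; exact hAY
  | rung ht hX ih =>
      obtain ⟨hc, hp, hm, hd, hs, hAX, -, hDX, -⟩ := goodX_of_orbX hP hq hX
      rw [Frail_rungStep]
      refine hP.add (hP.add (hP.add (hP.add ih (hP.mul ?_ hAX)) (hP.mul ?_ hAY)) (hP.mul ?_ hDY)) ?_
      all_goals (clear ih hAX hDX hAY hDY hAmY hDmY; apply_rules (maxDepth := 3000) [hP.add, hP.mul, hP.pow, hP.zero, hP.one, hP.ofNat])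
  | pendU hρ hX ih =>
      rw [Frail_qpendU]
      refine hP.mul ?_ ih
      clear ih hAY hDY hAmY hDmY; apply_rules (maxDepth := 3000) [hP.add, hP.mul, hP.pow, hP.zero, hP.one, hP.ofNat]
  | @pendW ρ X hρ hX ih =>
      obtain ⟨hc, hp, hm, hd, hs, -, -, -, -⟩ := goodX_of_orbX hP hq hX
      have h1 : P (FpendWN1 q ρ X Y) := by clear ih hAY hDY hAmY hDmY; unfold FpendWN1; apply_rules (maxDepth := 3000) [hP.add, hP.mul, hP.pow, hP.zero, hP.one, hP.ofNat]
      have h2 : P (FpendWN2 q ρ X Y) := by clear ih hAY hDY hAmY hDmY h1; unfold FpendWN2; apply_rules (maxDepth := 3000) [hP.add, hP.mul, hP.pow, hP.zero, hP.one, hP.ofNat]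
      have h3 : P (FpendWN3 q ρ X Y) := by clear ih hAY hDY hAmY hDmY h1 h2; unfold FpendWN3; apply_rules (maxDepth := 3000) [hP.add, hP.mul, hP.pow, hP.zero, hP.one, hP.ofNat]
      rw [Frail_qpendW]
      exact hP.add (hP.add (hP.add (hP.mul (hP.pow hρ 2) ih) h1) h2) h3
  | pendX hρ hX ih =>
      rw [Frail_qpendX]
      refine hP.mul ?_ ih
      clear ih hAY hDY hAmY hDmY; apply_rules (maxDepth := 3000) [hP.add, hP.mul, hP.pow, hP.zero, hP.one, hP.ofNat]
  | @edgeU ρ X hρ hX ih =>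
      have gX := goodX_of_orbX hP hq hX
      rw [Frail_edgeXU]
      refine hP.add (hP.add ih (hP.mul hρ ?_)) (hP.mul (hP.pow hρ 2) ?_)
      · exact hP.add (hP.add (FedgeU1a_pos hP hq gX gY ih) (FedgeU1b_pos hP hq gX gY)) (FedgeU1c_pos hP hq gX gY)
      · exact hP.add (hP.add (FedgeU2a_pos hP hq gX gY) (FedgeU2b_pos hP hq gX gY)) (FedgeU2c_pos hP hq gX gY)
  | @edgeW ρ X hρ hX ih =>
      have gX := goodX_of_orbX hP hq hX
      rw [Frail_edgeXW]
      refine hP.add (hP.add ih (hP.mul hρ ?_)) (hP.mul (hP.pow hρ 2) ?_)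
      · exact hP.add (FedgeW1a_pos hP hq gX gY) (FedgeW1b_pos hP hq gX gY)
      · exact FedgeW2a_pos hP hq gX gY
  | merge hX ih =>
      obtain ⟨hc, hp, hm, hd, hs, -, -, -, -⟩ := goodX_of_orbX hP hq hX
      rw [Frail_mergeUW]
      refine hP.mul ?_ hAY
      clear ih hAY hDY hAmY hDmY; apply_rules (maxDepth := 3000) [hP.add, hP.mul, hP.pow, hP.zero, hP.one, hP.ofNat]

end Cone

section Real

variable {S : Type*} [CommRing S] [LinearOrder S] [IsStrictOrderedRing S]

/-- THE RAIL THEOREM ON `𝒦⁺ × 𝒦⁺`, real form: for every `q ≥ 0` and any two sides of the extended orbit with nonnegative weights the two-copy core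
`P_{X ∪_w Y + zu + av; av, zu}(q;y)/q³ = Frail q X Y` is `≥ 0` — Rayleigh negative correlation of `av` and `zu` at every `0 < q < 1`. [this work] -/
theorem railX_allq_nonneg {q : S} (hq : 0 ≤ q) {X Y : SVec S} (hX : OrbX (fun x : S => 0 ≤ x) q X) (hY : OrbX (fun x : S => 0 ≤ x) q Y) :
    0 ≤ Frail q X Y :=
  Frail_pos_of_orbX (P := fun x : S => 0 ≤ x) isPosCone_nonneg hq hX hY

end Real

section Graded

variable {S : Type*} [CommRing S] [LinearOrder S] [IsStrictOrderedRing S]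

open Polynomial

/-- THE RAIL THEOREM ON `𝒦⁺ × 𝒦⁺`, graded form: with `q = X` and weights polynomials with nonnegative coefficients, every coefficient of the rail
form of two extended-orbit sides is `≥ 0`. [this work] -/
theorem railX_coeff_nonneg {K L : SVec S[X]} (hK : OrbX (fun p : S[X] => ∀ n, 0 ≤ p.coeff n) X K)
    (hL : OrbX (fun p : S[X] => ∀ n, 0 ≤ p.coeff n) X L) (n : ℕ) : 0 ≤ (Frail X K L).coeff n :=
  Frail_pos_of_orbX (P := fun p : S[X] => ∀ n, 0 ≤ p.coeff n) isPosCone_coeff (fun n => by rw [coeff_X]; split_ifs <;> norm_num) hK hL n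

end Graded

end TwoCopyLadderAllGrades

end Summit.CriticalPhenomena.PercolationContinuityZ3.Theorems
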